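import Summits.CriticalPhenomena.PercolationContinuityZ3.Theorems.Transplant.SkelPhiConcExcess
import Summits.CriticalPhenomena.PercolationContinuityZ3.Theorems.Transplant.KNCells2SepQO
import Summits.CriticalPhenomena.PercolationContinuityZ3.Theorems.Transplant.KNCells2CorridorSub
import Summits.CriticalPhenomena.PercolationContinuityZ3.Theorems.Transplant.BoxProdZ2SeedGeom
import HarnessLib

/-!
# N2 (frames-only node `SamePDropOfSkeletonFrm₁`, OPEN), (C) column: **THE RIM EXCESS OF THE CORRIDOR TEST, SCHEME-GENERIC, ORIENTED** —
# `KNCells.KSchA.real_rim_le_corrO`: the `hexc` row of `reachChainF_of_kgCorr(Y)` (SkelPhiCorridorKGReach / KGYReach).  For ANY anchored scheme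
# `S` with `LevelGeom/QSepGeom/StepsGeom`, an oriented valid run history (`Valid₂O`), `a' ∈ anchSet (aOf₁O h e) (tgt e)`, `du ∈ onwardO`: under the
# corridor law `Wcor` the root is joined to a RIM set (fresh-habitat vertices of `E_{x,y} ∪ H` inside the habitat proper `Q ∪ E^far`, beyond depth
# `R − L′` from `w₀`) with probability `≤ η`, given: every explored neighbour of the fresh world is `R₀`-deep (`hdeep`), a uniform excess radius `R₁ ≤ R − L′`
# for entrance depth `R₀ + 1` and planar spread `m` (`hR₁`, stmt's budget from `CylSubcritical`), and the two VERTEX-FORM rows of the world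
# `Wld := E_{x,y} ∪ H`: `hWπ` (it lies in `B(w₀, Rw)`) and `hWpl` (its planar footprints under `φ` lie in a translate of `box 2 m'`, `2m' ≤ m`).
# This is N1's `real_rim_le_concSG₂` (SkelPhiNegReachExcess p286064, C-A6) with the scheme abstracted and the validity oriented; at hp-8 g40's
# `cellGeomSG₂bS` the two rows are `mem_graphBall_of_mem_VWin/VStair` + the planar `…_subset_box_image` facts (the Geom pen's ten lines).
builds on p205010 (kernel theorem, internal audit signed; external expert review pending) — nothing in this file uses p205010; nothing here is a
claim about the open node `SamePDropOfSkeletonFrm₁`.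
Lane `prim-bschramm`, seat `prim-bschramm-p5` (gen 15; (C) lineage); helper file (`--supports stmt-CriticalPhenomena-4575 --as helper`).
[cite: KozmaNitzan2024, §4 Lemma 12 (pp. 23–25), p. 31]
-/

noncomputable section

open MeasureTheory
open scoped Classical

namespace Summit.CriticalPhenomena.PercolationContinuityZ3.Theorems

namespace Transplant

namespace KNCells

namespace KSchA

open Literature.Probability.Percolation Literature.Probability.LatticeModels SimpleGraph GadgetSystem ProbeHistory HSiteScheme Contour
open KNLevels
open Literature.Probability.Percolation.GM
open Literature.Barriers.CriticalPhenomena (graphBall graphBall_mono)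
open Skel (excess winGraphIn winGraphIn_le winGraphIn_adj)

variable {V : Type} [DecidableEq V] [Countable V] {G : SimpleGraph V} [G.LocallyFinite] {S : KSchA V ℕ} {FD : FaceData V ℕ} {LD : LevelData V ℕ}
variable {h : ProbeHistory V} {e : Site 2 × MDir} {a' : ℕ} {du : MDir}

/-- **RIM EXCESS OF THE CORRIDOR TEST, SCHEME-GENERIC, ORIENTED.** [cite: KozmaNitzan2024, §4 Lemma 12 (pp. 23–25), p. 31] [this work] -/
theorem real_rim_le_corrO (φ : V → Site 2) (hL : LevelGeom G S.Γ FD LD) (hQ : QSepGeom G S.Γ) (hSt : StepsGeom S.Γ FD) (hV : S.Valid₂O G h e)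
    (ha' : a' ∈ S.Γ.anchSet (S.aOf₁O G h e) (tgt e)) (hdu : du ∈ S.onwardO G h (tgt e))
    {w₀ : V} {Rw : ℕ}
    (hWπ : ∀ b ∈ S.Γ.Ewv (S.aOf₁O G h e) e.1 e.2 ∪ FD.Hfull a' (tgt e) du, b ∈ graphBall G w₀ Rw)
    {m' : ℕ} {ctr : Site 2}
    (hWpl : ∀ b ∈ S.Γ.Ewv (S.aOf₁O G h e) e.1 e.2 ∪ FD.Hfull a' (tgt e) du, φ b ∈ (box 2 m').image (fun s => s + ctr))
    {R₀ : ℕ}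
    (hdeep : ∀ a ∈ S.Vx G h, ∀ b ∈ S.Γ.Ewv (S.aOf₁O G h e) e.1 e.2 ∪ FD.Hfull a' (tgt e) du, b ∉ S.Vx G h → G.Adj a b → a ∈ graphBall G w₀ R₀)
    {R L' : ℕ} {η : ℝ} {R₁ m : ℕ} (hm : 2 * m' ≤ m)
    (hR₁ : ∀ R', R₁ ≤ R' → ∀ (Rw' : ℕ) (D' A' : Finset V), (∀ d ∈ D', d ∈ graphBall G w₀ Rw') →
      (∀ d ∈ D', ∀ d' ∈ D', φ d - φ d' ∈ box 2 m) → A' ⊆ D' → (∀ a ∈ A', a ∈ graphBall G w₀ (R₀ + 1)) →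
        (bondPercolation G S.p).real (excess G w₀ R' D' A') ≤ η)
    (hR : R₁ ≤ R - L') {Rim : Finset V} (hRim : Rim ⊆ S.Γ.Ewv (S.aOf₁O G h e) e.1 e.2 ∪ FD.Hfull a' (tgt e) du)
    (hRimHab : Rim ⊆ S.Γ.Q (S.aOf₁O G h e) (tgt e) ∪ S.Γ.Efar a' (tgt e) du) (hRimfar : ∀ t' ∈ Rim, t' ∉ graphBall G w₀ (R - L')) :
    (prodBernoulli (S.Wcor G FD h e (S.aOf₁O G h e) a' du)).real (⋃ t' ∈ Rim, openConn S.Γ.root t') ≤ η := by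
  set α := S.aOf₁O G h e with hα
  -- the fresh world `Wld = E_{x,y} ∪ H` and its unexplored part `D`
  set Wld : Finset V := S.Γ.Ewv α e.1 e.2 ∪ FD.Hfull a' (tgt e) du with hWld
  set D : Finset V := Wld.filter (fun b => b ∉ S.Vx G h) with hDdef
  -- `Wld ⊆ Sx` and `Wld ⊆ Ucor`
  have hWSx : Wld ⊆ S.Sx G h e α a' du := by
    intro v hv
    rcases Finset.mem_union.1 hv with hv | hv
    · exact Finset.mem_union_left _ (Finset.mem_union_right _ hv)
    · rcases Finset.mem_union.1 (hSt.Hfull_subset _ _ _ _ ha' hv) with hv' | hv'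
      · exact Finset.mem_union_left _ (Finset.mem_union_right _ (Finset.mem_union_right _ hv'))
      · exact Finset.mem_union_right _ hv'
  have hWU : Wld ⊆ S.Ucor G FD h e α a' du := by
    intro v hv
    rcases Finset.mem_union.1 hv with hv | hv
    · exact Finset.mem_union_left _ (Finset.mem_union_right _ hv)
    · exact Finset.mem_union_right _ hv
  have hDW : D ⊆ Wld := Finset.filter_subset _ _
  have hDV : ∀ b ∈ D, b ∉ S.Vx G h := fun b hb => (Finset.mem_filter.1 hb).2
  -- vertices of `Ucor` outside `D` are explored
  have hUout : ∀ x ∈ S.Ucor G FD h e α a' du, x ∉ D → x ∈ S.Vx G h := by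
    intro x hx hxD
    by_contra hxV
    rcases Finset.mem_union.1 hx with hx | hx
    · rcases Finset.mem_union.1 hx with hx | hx
      · exact hxV hx
      · exact hxD (Finset.mem_filter.2 ⟨Finset.mem_union_left _ hx, hxV⟩)
    · exact hxD (Finset.mem_filter.2 ⟨Finset.mem_union_right _ hx, hxV⟩)
  -- the subbox property of `Wcor` on `D` in the window graph of the corridor world
  have hWD : IsSubbox (winGraphIn G (S.Ucor G FD h e α a' du)) (S.Wcor G FD h e α a' du) S.p D :=
    KSchA.isSubbox_Wcor_graph (winGraphIn G (S.Ucor G FD h e α a' du)) (winGraphIn_le G _) hV.F_eq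
      (hDW.trans hWSx) (hDW.trans hWU) (Finset.disjoint_left.2 fun b hb hbV => hDV b hb hbV)
      (fun u hu v hv huv => (winGraphIn_adj G).2 ⟨huv, hWU (hDW hu), hWU (hDW hv)⟩)
      (fun v hv x hx _ hadj => (winGraphIn_adj G).2 ⟨hadj, hx, hWU (hDW hv)⟩)
  -- `Wcor` vanishes off the edges of `G`
  have hWG : ∀ x, x ∉ G.edgeSet → S.Wcor G FD h e α a' du x = 0 := by
    intro x hx
    by_cases hxU : x ∈ wireSet (↑(S.Ucor G FD h e α a' du) : Set V)
    · by_cases hxS : x ∈ wireSet (↑(S.Sx G h e α a' du) : Set V)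
      · have hxF : x ∉ S.F G h := by
          intro hxF
          rw [hV.F_eq, mem_edgesIn_iff] at hxF
          exact hx hxF.1
        rw [KSchA.Wcor_apply_of_mem hxU hxS hxF, KNLevels.lattW_apply, if_neg hx]
      · show restrW _ (restrW _ _) x = 0
        rw [restrW_apply_of_mem _ hxU, restrW_apply_of_not_mem _ hxS]
    · exact restrW_apply_of_not_mem _ hxU
  -- the root is explored, hence outside `D`
  have hroot : S.Γ.root ∉ D := fun hr => hDV _ hr hV.root_mem
  -- the rim lies in `D`: inside the world (hypothesis) and fresh (separation of the habitat from the explored region, oriented)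
  have hRimD : Rim ⊆ D := by
    intro t' ht
    refine Finset.mem_filter.2 ⟨hRim ht, fun htV => ?_⟩
    exact Finset.disjoint_left.1 (disjoint_Vx_of_freshO hL hQ hV hdu hRimHab) ht htV
  -- entrances are deep
  have hA : ∀ a b, a ∉ D → b ∈ D → G.Adj a b → S.Wcor G FD h e α a' du s(a, b) ≠ 0 → b ∈ graphBall G w₀ (R₀ + 1) := by
    intro a b haD hbD hadj hW
    have haU : a ∈ S.Ucor G FD h e α a' du := by
      by_contra haU
      exact hW (restrW_apply_of_not_mem _ fun hw => haU (Finset.mem_coe.1 (mk_mem_wireSet_iff.1 hw).1))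
    have haV : a ∈ S.Vx G h := hUout a haU haD
    exact BoxProdZ2.mem_graphBall_succ_of_adj G (hdeep a haV b (hDW hbD) (hDV b hbD) hadj) hadj
  -- planar spread of `D`: differences of footprints lie in `box 2 m`
  have hDm : ∀ d ∈ D, ∀ d' ∈ D, φ d - φ d' ∈ box 2 m := by
    intro d hd d' hd'
    obtain ⟨s, hs, hse⟩ := Finset.mem_image.1 (hWpl d (hDW hd))
    obtain ⟨s', hs', hse'⟩ := Finset.mem_image.1 (hWpl d' (hDW hd'))
    rw [← hse, ← hse', show s + ctr - (s' + ctr) = s - s' by abel]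
    rw [mem_box] at hs hs' ⊢
    intro i
    have h1 := hs i
    have h2 := hs' i
    simp only [Pi.sub_apply]
    omega
  exact Skelφ.real_rim_le_of_radius_In (φ := φ) (Wt := S.Wcor G FD h e α a' du) (q := S.p) (D := D) hWD (hDW.trans hWU) hWG hroot
    hRimD hRimfar hA hR₁ hR (fun b hb => hWπ b (hDW hb)) hDm

end KSchA

end KNCells

end Transplant

end Summit.CriticalPhenomena.PercolationContinuityZ3.Theorems

end
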